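import Summits.CriticalPhenomena.PercolationContinuityZ3.Theorems.Transplant.FKConnectivityAllQForestAdjacentDegThree
import Summits.CriticalPhenomena.PercolationContinuityZ3.Theorems.Transplant.FKConnectivityAllQForestAdjacentTwoSumSameSideFibres
import HarnessLib

/-!
# Vertex elimination at a vertex of degree three: the CLAW DECOMPOSITION of a fibre count

Support file (`--supports stmt-CriticalPhenomena-4575`), FK sub-lane `prim-bschramm-fk-1` (generation 23) of the post-continuity programme;
builds on p205010 (kernel theorem, internal audit signed; external expert review pending).  No definitions, no named facts, no sorries;
standard axioms.

THE IDENTITY.  Fibre `(M, u₀)` on the vertex type `V` (`M` free pairs, `u₀` pinned pairs), a vertex `z` whose pairs in `M ∪ u₀` are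
exactly the three FREE pairs `za, zb, zc` (`z, a, b, c` distinct), written `M = {za, zb, zc} ∪ M'` with `z` isolated in `M' ∪ u₀`.  For events
`P, Q` that do not look at the three pairs at `z` (`ω ∪ {g} ∈ P ↔ ω ∈ P` for `g ∈ {za, zb, zc}`), splitting the configurations `ω` of the
fibre by `ω ∩ {za, zb, zc} = S` and deleting `z` gives (`Fo` = forest configurations, `#` = `fibreCount`, `{p ↮ q}` = not joined in the
configuration)
  `#_{(M,u₀)}(Fo ∩ P, Fo ∩ Q) = #_{(M',u₀)}(Fo ∩ {a ↮ b, a ↮ c, b ↮ c} ∩ P, Fo ∩ Q) + #_{(M',u₀)}(Fo ∩ P, Fo ∩ {a ↮ b, a ↮ c, b ↮ c} ∩ Q)`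
  `  + Σ_{pq ∈ {ab, ac, bc}} [ #_{(M',u₀)}(Fo ∩ {p ↮ q} ∩ P, Fo ∩ Q) + #_{(M',u₀)}(Fo ∩ P, Fo ∩ {p ↮ q} ∩ Q) ]`
(`S = {za,zb,zc}`: the configuration minus `z` must separate `a, b, c` pairwise and its partner has `z` isolated; `|S| = 2`: it separates the two
feet of `S` and `z` is a leaf of the partner; `|S| ≤ 1`: symmetrically) — **`fibreCount_forest_claw_decomp`**.  This is the exact form of the
"degree-3 vertex elimination" `(Same − Diff)(G) = 2Δ₃(z) + Σ_{pq ⊆ N(z)} (Same − Diff)(G − z + pq)` of the seat memo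
(bschramm/FROM-fk-1-g23-VERTEX-ELIMINATION.md §1): the two CLAW terms are the new objects, the three pair terms are node counts on the fibres
`(M' ∪ {pq}, u₀)` (`fibreCount_insert_one`) or `(M' ∖ {pq}, u₀ ∪ {pq})`.

Also here: the two bookkeeping conversions used by the triangle-claw reduction (`…ForestTriangleClaw`):
* **`fibreCount_forest_sep_of_mem`** — if the pair `g = pq` is itself FREE (`g ∈` the free part), the conditioned count
  `#_{(M'∪{g},u₀)}(Fo ∩ {p ↮ q} ∩ P, Fo ∩ Q)` equals the plain count `#_{(M', u₀ ∪ {g})}(Fo ∩ P, Fo ∩ Q)` on the fibre with `g` PINNED;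
* **`fibreCount_forest_sep_add_of_notMem`** — if `g ∉ M' ∪ u₀`, the two conditioned counts add up to the plain count on `(M' ∪ {g}, u₀)`.
[cite: SempleWelsh2008, Conj. 1.1 (p. 2)] [cite: Linusson2011, Prop. 2.6] [cite: Grimmett2006, §1.5 (p. 13)]
-/

noncomputable section

namespace Summit.CriticalPhenomena.PercolationContinuityZ3.Theorems
namespace FK

open MeasureTheory Set Literature.Probability.LatticeModels Literature.Probability.Percolation
open scoped Classical symmDiff

variable {V : Type*} [Fintype V]

/-! ### Conversions for one conditioned pair -/

section Conversions

variable {M u₀ : BondConfig V} {p q : V} {P Q : Set (BondConfig V)}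

/-- **A free pair conditioned to separate its ends is a pinned pair.**  For `g = pq ∉ M ∪ u₀` (`p ≠ q`) and events `P, Q` blind to `g`:
`#_{(M ∪ {g}, u₀)}(Fo ∩ {p ↮ q} ∩ P, Fo ∩ Q) = #_{(M, u₀ ∪ {g})}(Fo ∩ P, Fo ∩ Q)`. [cite: Linusson2011, Prop. 2.6] [cite: Grimmett2006, §1.5 (p. 13)] -/
theorem fibreCount_forest_sep_of_mem (hpq : p ≠ q) (hgM : s(p, q) ∉ M) (hgu : s(p, q) ∉ u₀)
    (hP : ∀ ω, insert s(p, q) ω ∈ P ↔ ω ∈ P) (hQ : ∀ ω, insert s(p, q) ω ∈ Q ↔ ω ∈ Q) :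
    fibreCount (insert s(p, q) M) u₀ (forestEv V ∩ {ω | ¬ (openGraph ω).Reachable p q} ∩ P) (forestEv V ∩ Q) =
      fibreCount M (insert s(p, q) u₀) (forestEv V ∩ P) (forestEv V ∩ Q) := by
  have hgω : ∀ {ω : BondConfig V}, ω \ M = u₀ → s(p, q) ∉ ω := fun {ω} hω h => (mem_union_of_fibre hω h).elim hgM hgu
  have hgζ : ∀ {ω : BondConfig V}, ω \ M = u₀ → s(p, q) ∉ ω ∆ M := fun {ω} hω h => (mem_union_of_fibre_symmDiff hω h).elim hgM hgu
  have hins : ∀ {ω : BondConfig V}, s(p, q) ∉ ω → (IsForestCfg (insert s(p, q) ω) ↔ IsForestCfg ω ∧ ¬ (openGraph ω).Reachable p q) :=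
    fun h => isForestCfg_insert_iff hpq h
  rw [fibreCount_insert_one hgM, fibreCount_insert_pinned hgM hgu]
  -- the branch where `g` goes to the configuration is empty (`g ∈ ω ∪ {g}` joins `p, q`)
  have e0 : fibreCount M u₀ ({ω | s(p, q) ∉ ω} ∩ {ω | insert s(p, q) ω ∈ forestEv V ∩ {ω | ¬ (openGraph ω).Reachable p q} ∩ P})
      ({ω | s(p, q) ∉ ω} ∩ (forestEv V ∩ Q)) = 0 := by
    refine fibreCount_eq_zero_of_left M u₀ ?_ _
    rw [Set.eq_empty_iff_forall_notMem]
    rintro ω ⟨-, ⟨-, hsep⟩, -⟩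
    exact hsep ((openGraph_adj _ _ _).2 ⟨mem_insert _ _, hpq⟩).reachable
  rw [e0, zero_add]
  refine fibreCount_congr_fibre _ _ fun ω hω => ?_
  simp only [mem_inter_iff, mem_setOf_eq, forestEv, hins (hgω hω), hins (hgζ hω), hP, hQ, hgω hω, not_false_eq_true, true_and]
  tauto

/-- **A pair outside the fibre, conditioned on either side, is a free pair.**  For `g = pq ∉ M ∪ u₀` (`p ≠ q`) and events `P, Q` blind to `g`:
`#_{(M,u₀)}(Fo ∩ {p ↮ q} ∩ P, Fo ∩ Q) + #_{(M,u₀)}(Fo ∩ P, Fo ∩ {p ↮ q} ∩ Q) = #_{(M ∪ {g}, u₀)}(Fo ∩ P, Fo ∩ Q)`.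
[cite: Linusson2011, Prop. 2.6] [cite: Grimmett2006, §1.5 (p. 13)] -/
theorem fibreCount_forest_sep_add_of_notMem (hpq : p ≠ q) (hgM : s(p, q) ∉ M) (hgu : s(p, q) ∉ u₀)
    (hP : ∀ ω, insert s(p, q) ω ∈ P ↔ ω ∈ P) (hQ : ∀ ω, insert s(p, q) ω ∈ Q ↔ ω ∈ Q) :
    fibreCount M u₀ (forestEv V ∩ {ω | ¬ (openGraph ω).Reachable p q} ∩ P) (forestEv V ∩ Q) +
        fibreCount M u₀ (forestEv V ∩ P) (forestEv V ∩ {ω | ¬ (openGraph ω).Reachable p q} ∩ Q) =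
      fibreCount (insert s(p, q) M) u₀ (forestEv V ∩ P) (forestEv V ∩ Q) := by
  have hgω : ∀ {ω : BondConfig V}, ω \ M = u₀ → s(p, q) ∉ ω := fun {ω} hω h => (mem_union_of_fibre hω h).elim hgM hgu
  have hgζ : ∀ {ω : BondConfig V}, ω \ M = u₀ → s(p, q) ∉ ω ∆ M := fun {ω} hω h => (mem_union_of_fibre_symmDiff hω h).elim hgM hgu
  have hins : ∀ {ω : BondConfig V}, s(p, q) ∉ ω → (IsForestCfg (insert s(p, q) ω) ↔ IsForestCfg ω ∧ ¬ (openGraph ω).Reachable p q) :=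
    fun h => isForestCfg_insert_iff hpq h
  rw [fibreCount_insert_one hgM]
  congr 1
  · refine fibreCount_congr_fibre _ _ fun ω hω => ?_
    simp only [mem_inter_iff, mem_setOf_eq, forestEv, hins (hgω hω), hP, hgω hω, not_false_eq_true, true_and]
    tauto
  · refine fibreCount_congr_fibre _ _ fun ω hω => ?_
    simp only [mem_inter_iff, mem_setOf_eq, forestEv, hins (hgζ hω), hQ, hgω hω, not_false_eq_true, true_and]
    tauto

/-- A pair pinned in the fibre cannot separate its ends: `#_{(M,u₀)}(Fo ∩ {p ↮ q} ∩ P, Q) = 0` when `pq ∈ u₀` (`p ≠ q`). [folklore] -/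
theorem fibreCount_forest_sep_eq_zero_of_mem_pinned (hpq : p ≠ q) (hgu : s(p, q) ∈ u₀) (P Q : Set (BondConfig V)) :
    fibreCount M u₀ (forestEv V ∩ {ω | ¬ (openGraph ω).Reachable p q} ∩ P) Q = 0 := by
  have h0 : fibreCount M u₀ (∅ : Set (BondConfig V)) Q = 0 := fibreCount_eq_zero_of_left M u₀ rfl Q
  refine Nat.eq_zero_of_le_zero (h0 ▸ fibreCount_mono_fibre M u₀ fun ω hω hA _ => ?_)
  obtain ⟨⟨-, hsep⟩, -⟩ := hA
  have hg : s(p, q) ∈ ω := by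
    have : s(p, q) ∈ ω \ M := by rw [hω]; exact hgu
    exact this.1
  exact absurd ((openGraph_adj _ _ _).2 ⟨hg, hpq⟩).reachable hsep

/-- Symmetric form: `#_{(M,u₀)}(P, Fo ∩ {p ↮ q} ∩ Q) = 0` when `pq ∈ u₀` (`p ≠ q`). [folklore] -/
theorem fibreCount_forest_sep_eq_zero_of_mem_pinned' (hpq : p ≠ q) (hgu : s(p, q) ∈ u₀) (P Q : Set (BondConfig V)) :
    fibreCount M u₀ P (forestEv V ∩ {ω | ¬ (openGraph ω).Reachable p q} ∩ Q) = 0 := by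
  rw [fibreCount_swap]; exact fibreCount_forest_sep_eq_zero_of_mem_pinned hpq hgu Q P

end Conversions

/-! ### The claw decomposition -/

section Claw

variable {M' u₀ : BondConfig V} {z a b c : V} {P Q : Set (BondConfig V)}

/-- **CLAW DECOMPOSITION (degree-3 vertex elimination).**  `z` isolated in `M' ∪ u₀`, `z, a, b, c` distinct, `P, Q` blind to the three
pairs `za, zb, zc`.  Then on the fibre `({za,zb,zc} ∪ M', u₀)`:
`#(Fo ∩ P, Fo ∩ Q) = #'(Fo ∩ S_abc ∩ P, Fo ∩ Q) + #'(Fo ∩ P, Fo ∩ S_abc ∩ Q) + Σ_{pq ∈ {ab,ac,bc}} [#'(Fo ∩ S_pq ∩ P, Fo ∩ Q) + #'(Fo ∩ P, Fo ∩ S_pq ∩ Q)]`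
with `#'` the count on `(M', u₀)`, `S_pq = {p ↮ q}`, `S_abc = S_ab ∩ S_ac ∩ S_bc`.
[cite: SempleWelsh2008, Conj. 1.1 (p. 2)] [cite: Linusson2011, Prop. 2.6] [cite: Grimmett2006, §1.5 (p. 13)] -/
theorem fibreCount_forest_claw_decomp (hz : ∀ g ∈ M' ∪ u₀, z ∉ g) (hza : z ≠ a) (hzb : z ≠ b) (hzc : z ≠ c)
    (hab : a ≠ b) (hac : a ≠ c) (hbc : b ≠ c)
    (hPa : ∀ ω, insert s(z, a) ω ∈ P ↔ ω ∈ P) (hPb : ∀ ω, insert s(z, b) ω ∈ P ↔ ω ∈ P) (hPc : ∀ ω, insert s(z, c) ω ∈ P ↔ ω ∈ P)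
    (hQa : ∀ ω, insert s(z, a) ω ∈ Q ↔ ω ∈ Q) (hQb : ∀ ω, insert s(z, b) ω ∈ Q ↔ ω ∈ Q) (hQc : ∀ ω, insert s(z, c) ω ∈ Q ↔ ω ∈ Q) :
    fibreCount (insert s(z, a) (insert s(z, b) (insert s(z, c) M'))) u₀ (forestEv V ∩ P) (forestEv V ∩ Q) =
      (fibreCount M' u₀ (forestEv V ∩ {ω | ¬ (openGraph ω).Reachable a b ∧ ¬ (openGraph ω).Reachable a c ∧
          ¬ (openGraph ω).Reachable b c} ∩ P) (forestEv V ∩ Q) +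
        fibreCount M' u₀ (forestEv V ∩ P) (forestEv V ∩ {ω | ¬ (openGraph ω).Reachable a b ∧ ¬ (openGraph ω).Reachable a c ∧
          ¬ (openGraph ω).Reachable b c} ∩ Q)) +
      (fibreCount M' u₀ (forestEv V ∩ {ω | ¬ (openGraph ω).Reachable a b} ∩ P) (forestEv V ∩ Q) +
        fibreCount M' u₀ (forestEv V ∩ P) (forestEv V ∩ {ω | ¬ (openGraph ω).Reachable a b} ∩ Q)) +
      (fibreCount M' u₀ (forestEv V ∩ {ω | ¬ (openGraph ω).Reachable a c} ∩ P) (forestEv V ∩ Q) +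
        fibreCount M' u₀ (forestEv V ∩ P) (forestEv V ∩ {ω | ¬ (openGraph ω).Reachable a c} ∩ Q)) +
      (fibreCount M' u₀ (forestEv V ∩ {ω | ¬ (openGraph ω).Reachable b c} ∩ P) (forestEv V ∩ Q) +
        fibreCount M' u₀ (forestEv V ∩ P) (forestEv V ∩ {ω | ¬ (openGraph ω).Reachable b c} ∩ Q)) := by
  -- the three pairs at `z` are outside `M' ∪ u₀`
  have hza' : s(z, a) ∉ insert s(z, b) (insert s(z, c) M') := by
    simp only [mem_insert_iff, not_or]
    exact ⟨fun h => hab (Sym2.congr_right.1 h), fun h => hac (Sym2.congr_right.1 h), fun h => hz _ (Or.inl h) (Sym2.mem_mk_left _ _)⟩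
  have hzb' : s(z, b) ∉ insert s(z, c) M' := by
    simp only [mem_insert_iff, not_or]
    exact ⟨fun h => hbc (Sym2.congr_right.1 h), fun h => hz _ (Or.inl h) (Sym2.mem_mk_left _ _)⟩
  have hzc' : s(z, c) ∉ M' := fun h => hz _ (Or.inl h) (Sym2.mem_mk_left _ _)
  -- on the fibre `(M', u₀)`, `z` is isolated in the configuration and in its partner
  have hiso : ∀ {ω : BondConfig V}, ω \ M' = u₀ → (∀ g ∈ ω, z ∉ g) ∧ (∀ g ∈ ω ∆ M', z ∉ g) := fun {ω} hω =>
    ⟨fun g hg => hz g ((subset_union_of_fibre hω).1 hg), fun g hg => hz g ((subset_union_of_fibre hω).2 hg)⟩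
  rw [fibreCount_insert_one hza', fibreCount_insert_one hzb', fibreCount_insert_one hzb', fibreCount_insert_one hzc',
    fibreCount_insert_one hzc', fibreCount_insert_one hzc', fibreCount_insert_one hzc']
  -- forests with pairs inserted at the isolated vertex `z`
  have pack : ∀ {ξ : BondConfig V}, (∀ g ∈ ξ, z ∉ g) →
      (s(z, a) ∉ ξ ∧ s(z, b) ∉ ξ ∧ s(z, c) ∉ ξ) ∧
      ((IsForestCfg (insert s(z, a) (insert s(z, b) (insert s(z, c) ξ))) ↔ IsForestCfg ξ ∧ ¬ (openGraph ξ).Reachable a b ∧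
          ¬ (openGraph ξ).Reachable a c ∧ ¬ (openGraph ξ).Reachable b c) ∧
        (IsForestCfg (insert s(z, a) (insert s(z, b) ξ)) ↔ IsForestCfg ξ ∧ ¬ (openGraph ξ).Reachable a b) ∧
        (IsForestCfg (insert s(z, a) (insert s(z, c) ξ)) ↔ IsForestCfg ξ ∧ ¬ (openGraph ξ).Reachable a c) ∧
        (IsForestCfg (insert s(z, b) (insert s(z, c) ξ)) ↔ IsForestCfg ξ ∧ ¬ (openGraph ξ).Reachable b c) ∧
        (IsForestCfg (insert s(z, a) ξ) ↔ IsForestCfg ξ) ∧ (IsForestCfg (insert s(z, b) ξ) ↔ IsForestCfg ξ) ∧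
        (IsForestCfg (insert s(z, c) ξ) ↔ IsForestCfg ξ)) := by
    intro ξ hξ
    refine ⟨⟨notMem_of_isolated hξ a, notMem_of_isolated hξ b, notMem_of_isolated hξ c⟩, ?_, ?_, ?_, ?_,
      isForestCfg_insert_of_isolated hξ hza, isForestCfg_insert_of_isolated hξ hzb, isForestCfg_insert_of_isolated hξ hzc⟩
    · rw [isForestCfg_insert_three_of_isolated hξ hzb hza hzc hab.symm hbc hac, SimpleGraph.reachable_comm (u := b) (v := a)]
      tauto
    · rw [isForestCfg_insert_two_of_isolated hξ hzb hza hab.symm, SimpleGraph.reachable_comm]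
    · rw [isForestCfg_insert_two_of_isolated hξ hzc hza hac.symm, SimpleGraph.reachable_comm]
    · rw [isForestCfg_insert_two_of_isolated hξ hzc hzb hbc.symm, SimpleGraph.reachable_comm]
  have hab' : s(z, a) ≠ s(z, b) := fun h => hab (Sym2.congr_right.1 h)
  have hac' : s(z, a) ≠ s(z, c) := fun h => hac (Sym2.congr_right.1 h)
  have hbc' : s(z, b) ≠ s(z, c) := fun h => hbc (Sym2.congr_right.1 h)
  -- the eight cells `(S | {a,b,c} ∖ S)`: pairs of `S` go to the configuration, the others to its partner
  have e1 : fibreCount M' u₀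
      ({ω | s(z, c) ∉ ω} ∩ {ω | insert s(z, c) ω ∈ {ω | s(z, b) ∉ ω} ∩ {ω | insert s(z, b) ω ∈ {ω | s(z, a) ∉ ω} ∩
        {ω | insert s(z, a) ω ∈ forestEv V ∩ P}}})
      ({ω | s(z, c) ∉ ω} ∩ ({ω | s(z, b) ∉ ω} ∩ ({ω | s(z, a) ∉ ω} ∩ (forestEv V ∩ Q)))) =
      fibreCount M' u₀ (forestEv V ∩ {ω | ¬ (openGraph ω).Reachable a b ∧ ¬ (openGraph ω).Reachable a c ∧
          ¬ (openGraph ω).Reachable b c} ∩ P) (forestEv V ∩ Q) :=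
    fibreCount_congr_fibre _ _ fun ω hω => by
      obtain ⟨⟨n1, n2, n3⟩, f3, fab, fac, fbc, fa, fb, fc⟩ := pack (hiso hω).1
      obtain ⟨⟨m1, m2, m3⟩, g3, gab, gac, gbc, ga, gb, gc⟩ := pack (hiso hω).2
      simp only [mem_inter_iff, mem_setOf_eq, forestEv, mem_insert_iff, hab', hac', hbc', n1, n2, n3, m1, m2, m3, f3,
        hPa, hPb, hPc, not_false_eq_true, true_and, false_or]
  have e2 : fibreCount M' u₀
      ({ω | s(z, c) ∉ ω} ∩ ({ω | s(z, b) ∉ ω} ∩ {ω | insert s(z, b) ω ∈ {ω | s(z, a) ∉ ω} ∩ {ω | insert s(z, a) ω ∈ forestEv V ∩ P}}))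
      ({ω | s(z, c) ∉ ω} ∩ {ω | insert s(z, c) ω ∈ {ω | s(z, b) ∉ ω} ∩ ({ω | s(z, a) ∉ ω} ∩ (forestEv V ∩ Q))}) =
      fibreCount M' u₀ (forestEv V ∩ {ω | ¬ (openGraph ω).Reachable a b} ∩ P) (forestEv V ∩ Q) :=
    fibreCount_congr_fibre _ _ fun ω hω => by
      obtain ⟨⟨n1, n2, n3⟩, f3, fab, fac, fbc, fa, fb, fc⟩ := pack (hiso hω).1
      obtain ⟨⟨m1, m2, m3⟩, g3, gab, gac, gbc, ga, gb, gc⟩ := pack (hiso hω).2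
      simp only [mem_inter_iff, mem_setOf_eq, forestEv, mem_insert_iff, hab', hac', hbc', n1, n2, n3, m1, m2, m3, fab, gc,
        hPa, hPb, hQc, not_false_eq_true, true_and, false_or]
  have e3 : fibreCount M' u₀
      ({ω | s(z, c) ∉ ω} ∩ {ω | insert s(z, c) ω ∈ {ω | s(z, b) ∉ ω} ∩ ({ω | s(z, a) ∉ ω} ∩ {ω | insert s(z, a) ω ∈ forestEv V ∩ P})})
      ({ω | s(z, c) ∉ ω} ∩ ({ω | s(z, b) ∉ ω} ∩ {ω | insert s(z, b) ω ∈ {ω | s(z, a) ∉ ω} ∩ (forestEv V ∩ Q)})) =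
      fibreCount M' u₀ (forestEv V ∩ {ω | ¬ (openGraph ω).Reachable a c} ∩ P) (forestEv V ∩ Q) :=
    fibreCount_congr_fibre _ _ fun ω hω => by
      obtain ⟨⟨n1, n2, n3⟩, f3, fab, fac, fbc, fa, fb, fc⟩ := pack (hiso hω).1
      obtain ⟨⟨m1, m2, m3⟩, g3, gab, gac, gbc, ga, gb, gc⟩ := pack (hiso hω).2
      simp only [mem_inter_iff, mem_setOf_eq, forestEv, mem_insert_iff, hab', hac', hbc', n1, n2, n3, m1, m2, m3, fac, gb,
        hPa, hPc, hQb, not_false_eq_true, true_and, false_or]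
  have e4 : fibreCount M' u₀
      ({ω | s(z, c) ∉ ω} ∩ ({ω | s(z, b) ∉ ω} ∩ ({ω | s(z, a) ∉ ω} ∩ {ω | insert s(z, a) ω ∈ forestEv V ∩ P})))
      ({ω | s(z, c) ∉ ω} ∩ {ω | insert s(z, c) ω ∈ {ω | s(z, b) ∉ ω} ∩ {ω | insert s(z, b) ω ∈ {ω | s(z, a) ∉ ω} ∩ (forestEv V ∩ Q)}}) =
      fibreCount M' u₀ (forestEv V ∩ P) (forestEv V ∩ {ω | ¬ (openGraph ω).Reachable b c} ∩ Q) :=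
    fibreCount_congr_fibre _ _ fun ω hω => by
      obtain ⟨⟨n1, n2, n3⟩, f3, fab, fac, fbc, fa, fb, fc⟩ := pack (hiso hω).1
      obtain ⟨⟨m1, m2, m3⟩, g3, gab, gac, gbc, ga, gb, gc⟩ := pack (hiso hω).2
      simp only [mem_inter_iff, mem_setOf_eq, forestEv, mem_insert_iff, hab', hac', hbc', n1, n2, n3, m1, m2, m3, fa, gbc,
        hPa, hQb, hQc, not_false_eq_true, true_and, false_or]
  have e5 : fibreCount M' u₀
      ({ω | s(z, c) ∉ ω} ∩ {ω | insert s(z, c) ω ∈ {ω | s(z, b) ∉ ω} ∩ {ω | insert s(z, b) ω ∈ {ω | s(z, a) ∉ ω} ∩ (forestEv V ∩ P)}})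
      ({ω | s(z, c) ∉ ω} ∩ ({ω | s(z, b) ∉ ω} ∩ ({ω | s(z, a) ∉ ω} ∩ {ω | insert s(z, a) ω ∈ forestEv V ∩ Q}))) =
      fibreCount M' u₀ (forestEv V ∩ {ω | ¬ (openGraph ω).Reachable b c} ∩ P) (forestEv V ∩ Q) :=
    fibreCount_congr_fibre _ _ fun ω hω => by
      obtain ⟨⟨n1, n2, n3⟩, f3, fab, fac, fbc, fa, fb, fc⟩ := pack (hiso hω).1
      obtain ⟨⟨m1, m2, m3⟩, g3, gab, gac, gbc, ga, gb, gc⟩ := pack (hiso hω).2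
      simp only [mem_inter_iff, mem_setOf_eq, forestEv, mem_insert_iff, hab', hac', hbc', n1, n2, n3, m1, m2, m3, fbc, ga,
        hPb, hPc, hQa, not_false_eq_true, true_and, false_or]
  have e6 : fibreCount M' u₀
      ({ω | s(z, c) ∉ ω} ∩ ({ω | s(z, b) ∉ ω} ∩ {ω | insert s(z, b) ω ∈ {ω | s(z, a) ∉ ω} ∩ (forestEv V ∩ P)}))
      ({ω | s(z, c) ∉ ω} ∩ {ω | insert s(z, c) ω ∈ {ω | s(z, b) ∉ ω} ∩ ({ω | s(z, a) ∉ ω} ∩ {ω | insert s(z, a) ω ∈ forestEv V ∩ Q})}) =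
      fibreCount M' u₀ (forestEv V ∩ P) (forestEv V ∩ {ω | ¬ (openGraph ω).Reachable a c} ∩ Q) :=
    fibreCount_congr_fibre _ _ fun ω hω => by
      obtain ⟨⟨n1, n2, n3⟩, f3, fab, fac, fbc, fa, fb, fc⟩ := pack (hiso hω).1
      obtain ⟨⟨m1, m2, m3⟩, g3, gab, gac, gbc, ga, gb, gc⟩ := pack (hiso hω).2
      simp only [mem_inter_iff, mem_setOf_eq, forestEv, mem_insert_iff, hab', hac', hbc', n1, n2, n3, m1, m2, m3, fb, gac,
        hPb, hQa, hQc, not_false_eq_true, true_and, false_or]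
  have e7 : fibreCount M' u₀
      ({ω | s(z, c) ∉ ω} ∩ {ω | insert s(z, c) ω ∈ {ω | s(z, b) ∉ ω} ∩ ({ω | s(z, a) ∉ ω} ∩ (forestEv V ∩ P))})
      ({ω | s(z, c) ∉ ω} ∩ ({ω | s(z, b) ∉ ω} ∩ {ω | insert s(z, b) ω ∈ {ω | s(z, a) ∉ ω} ∩ {ω | insert s(z, a) ω ∈ forestEv V ∩ Q}})) =
      fibreCount M' u₀ (forestEv V ∩ P) (forestEv V ∩ {ω | ¬ (openGraph ω).Reachable a b} ∩ Q) :=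
    fibreCount_congr_fibre _ _ fun ω hω => by
      obtain ⟨⟨n1, n2, n3⟩, f3, fab, fac, fbc, fa, fb, fc⟩ := pack (hiso hω).1
      obtain ⟨⟨m1, m2, m3⟩, g3, gab, gac, gbc, ga, gb, gc⟩ := pack (hiso hω).2
      simp only [mem_inter_iff, mem_setOf_eq, forestEv, mem_insert_iff, hab', hac', hbc', n1, n2, n3, m1, m2, m3, fc, gab,
        hPc, hQa, hQb, not_false_eq_true, true_and, false_or]
  have e8 : fibreCount M' u₀
      ({ω | s(z, c) ∉ ω} ∩ ({ω | s(z, b) ∉ ω} ∩ ({ω | s(z, a) ∉ ω} ∩ (forestEv V ∩ P))))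
      ({ω | s(z, c) ∉ ω} ∩ {ω | insert s(z, c) ω ∈ {ω | s(z, b) ∉ ω} ∩ {ω | insert s(z, b) ω ∈ {ω | s(z, a) ∉ ω} ∩
        {ω | insert s(z, a) ω ∈ forestEv V ∩ Q}}}) =
      fibreCount M' u₀ (forestEv V ∩ P) (forestEv V ∩ {ω | ¬ (openGraph ω).Reachable a b ∧ ¬ (openGraph ω).Reachable a c ∧
          ¬ (openGraph ω).Reachable b c} ∩ Q) :=
    fibreCount_congr_fibre _ _ fun ω hω => by
      obtain ⟨⟨n1, n2, n3⟩, f3, fab, fac, fbc, fa, fb, fc⟩ := pack (hiso hω).1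
      obtain ⟨⟨m1, m2, m3⟩, g3, gab, gac, gbc, ga, gb, gc⟩ := pack (hiso hω).2
      simp only [mem_inter_iff, mem_setOf_eq, forestEv, mem_insert_iff, hab', hac', hbc', n1, n2, n3, m1, m2, m3, g3,
        hQa, hQb, hQc, not_false_eq_true, true_and, false_or]
  rw [e1, e2, e3, e4, e5, e6, e7, e8]
  omega

end Claw

end FK
end Summit.CriticalPhenomena.PercolationContinuityZ3.Theorems

end
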